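import Literature.AlgebraicGeometry.Morphisms.CechH1FlatBaseChangeRank
import Literature.AlgebraicGeometry.Morphisms.CechH1AffineCoverIndependence
import Literature.AlgebraicGeometry.Motives.AbelianVarietyProjective
import Mathlib.FieldTheory.IsAlgClosed.AlgebraicClosure
import Mathlib.RingTheory.Flat.Basic
import HarnessLib

/-!
# `dim_K Ȟ¹(𝔘, 𝒪_A) = dim A` descends along a field extension: it suffices to know it for `A_L` (e.g. `L = K̄`)
# ([MumfordAV1970] §13 Cor. 2 over any field, from the algebraically closed case; [StacksProject] Tag 02KH flat base change of Čech cohomology)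

Layer `Literature/AlgebraicGeometry/AbelianVarieties`, namespace `Literature.AlgebraicGeometry.AbelianVarieties`.  THEOREMS ONLY (no definition, no named fact,
no instance, no notation, no `sorry`).  Cell `hodgecm-mathlib` (D-0151), P6 «MOD programme», pay-down «H1-DIM in characteristic `p`» (B-p04 (g41) MEMO-H1DIM-cut.v3,
HEAD `finrank_cechH1_structureSheaf_eq_dim`; this reduction piece by LA4-p05 (g0), offered 2026-09-02T03:00Z): the HEAD's «reduction from any `K` to `K̄`».
HC_CM is proved only modulo the printed citations until rung 0 closes; this file is generic and changes no count.

For an abelian variety `A` over a field `K`, a field extension `L ∕ K`, and a finite affine open cover `𝔘` of `A`: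
* `finrank_cechH1_structureSheaf_eq_dim_of_baseChange` — if `Ȟ¹(pr₁⁻¹𝔘, 𝒪_{A_L})` is finite over `L` of rank `dim A_L`, then `Ȟ¹(𝔘, 𝒪_A)` is finite over `K`
  of rank `dim A` (`L ∕ K` is flat: ★ `finrank_cechH1_baseChange` ∕ `finite_cechH1_baseChange_iff` along the cartesian square `A_L → A`; `finrank_L (L ⊗_K M) = finrank_K M`,
  Mathlib `Module.finrank_baseChange` ∕ `Module.rank_baseChange`; `dim A_L = dim A` ★ `dim_baseChange`);
* **`finrank_cechH1_structureSheaf_eq_dim_of_forall_cover_baseChange`** — the same with the hypothesis for ALL finite affine covers of `A_L` (the shape in which the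
  algebraically closed case is proved), instantiated at `pr₁⁻¹𝔘` (affine: `Spec L → Spec K` is affine);
* **`finrank_cechH1_structureSheaf_eq_dim_of_algClosure`** — `L := K̄` (Mathlib `AlgebraicClosure`): [MumfordAV1970] §13 Cor. 2 over every field follows from
  the algebraically closed case.

## References
* [MumfordAV1970] D. Mumford, *Abelian Varieties* (1970), §13 Cor. 2 (p. 129).
* [StacksProject] The Stacks Project, Tag 02KH (flat base change of Čech cohomology).
* [Hartshorne1977] R. Hartshorne, *Algebraic Geometry* (1977), III Prop. 9.3 (p. 255).
* [GortzWedhorn2020] U. Görtz, T. Wedhorn, *Algebraic Geometry I*, 2nd ed. (2020), Prop. 5.38 (p. 165).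
-/

set_option autoImplicit false

noncomputable section

open CategoryTheory CategoryTheory.Limits AlgebraicGeometry TensorProduct

namespace Literature.AlgebraicGeometry.AbelianVarieties

open Literature.AlgebraicGeometry.Morphisms Literature.AlgebraicGeometry.Motives

section Reduce

variable {K : Type} [Field K] (L : Type) [Field L] [Algebra K L] (A : AbelianVariety K)

/-- `finrank_L (L ⊗_K M) = finrank_K M` and `L ⊗_K M` finite over `L` iff `M` finite over `K` (modules over a field are free; Mathlib `Module.finrank_baseChange`,
`Module.rank_baseChange`). [folklore] -/
private theorem finrank_baseChange_field (M : Type) [AddCommGroup M] [Module K M] :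
    Module.finrank L (L ⊗[K] M) = Module.finrank K M ∧ (Module.Finite L (L ⊗[K] M) ↔ Module.Finite K M) := by
  refine ⟨Module.finrank_baseChange, ?_⟩
  rw [← Module.rank_lt_aleph0_iff, ← Module.rank_lt_aleph0_iff, Module.rank_baseChange, Cardinal.lift_lt_aleph0]

/-- **`dim Ȟ¹ = dim` DESCENDS ALONG A FIELD EXTENSION, one cover**: if `Ȟ¹(pr₁⁻¹𝔘, 𝒪_{A_L})` is finite over `L` of rank `dim A_L` then `Ȟ¹(𝔘, 𝒪_A)` is finite over
`K` of rank `dim A` ([StacksProject] 02KH along the flat `K → L`; `dim A_L = dim A`). [cite: StacksProject, Tag 02KH] [cite: MumfordAV1970, §13 Cor. 2 (p. 129)]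
[cite: GortzWedhorn2020, Prop. 5.38 (p. 165)] -/
theorem finrank_cechH1_structureSheaf_eq_dim_of_baseChange {κ : Type} [Finite κ] (U : κ → A.X.left.Opens) (hU : ∀ i, IsAffineOpen (U i))
    (h : Module.Finite L (CechH1 (A.baseChange L).X.hom
        (preimageFamily (pullback.fst A.X.hom (Spec.map (CommRingCat.ofHom (algebraMap K L)))) U)) ∧
      Module.finrank L (CechH1 (A.baseChange L).X.hom
        (preimageFamily (pullback.fst A.X.hom (Spec.map (CommRingCat.ofHom (algebraMap K L)))) U)) = (A.baseChange L).dim) :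
    Module.Finite K (CechH1 A.X.hom U) ∧ Module.finrank K (CechH1 A.X.hom U) = A.dim := by
  haveI := A.isProper
  haveI : QuasiSeparatedSpace A.X.left := quasiSeparatedSpace_of_quasiSeparated A.X.hom
  haveI : Module.Flat K L := inferInstance
  have H : IsPullback (pullback.fst A.X.hom (Spec.map (CommRingCat.ofHom (algebraMap K L)))) (A.baseChange L).X.hom A.X.hom
      (Spec.map (CommRingCat.ofHom (algebraMap K L))) := by
    rw [AbelianVariety.baseChange_X_hom]
    exact IsPullback.of_hasPullback _ _
  have hrk := finrank_cechH1_baseChange A.X.hom (A.baseChange L).X.hom _ U H hU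
  have hfin := finite_cechH1_baseChange_iff A.X.hom (A.baseChange L).X.hom _ U H hU
  obtain ⟨hbc1, hbc2⟩ := finrank_baseChange_field (K := K) L (CechH1 A.X.hom U)
  refine ⟨hbc2.mp (hfin.mp h.1), ?_⟩
  rw [← hbc1, ← hrk, h.2, AbelianVariety.dim_baseChange]

/-- **`dim Ȟ¹ = dim` DESCENDS ALONG A FIELD EXTENSION**: if `dim_L Ȟ¹(𝔘′, 𝒪_{A_L}) = dim A_L` (finite) for EVERY finite affine open cover `𝔘′` of `A_L`, then
`dim_K Ȟ¹(𝔘, 𝒪_A) = dim A` (finite) for every finite affine open cover `𝔘` of `A` — at `𝔘′ := pr₁⁻¹𝔘` (affine opens: `A_L → A` is affine).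
[cite: StacksProject, Tag 02KH] [cite: MumfordAV1970, §13 Cor. 2 (p. 129)] -/
theorem finrank_cechH1_structureSheaf_eq_dim_of_forall_cover_baseChange
    (h : ∀ {κ' : Type} [Finite κ'] (U' : κ' → (A.baseChange L).X.left.Opens), (∀ i, IsAffineOpen (U' i)) → iSup U' = ⊤ →
      Module.Finite L (CechH1 (A.baseChange L).X.hom U') ∧ Module.finrank L (CechH1 (A.baseChange L).X.hom U') = (A.baseChange L).dim)
    {κ : Type} [Finite κ] (U : κ → A.X.left.Opens) (hU : ∀ i, IsAffineOpen (U i)) (hUcov : iSup U = ⊤) :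
    Module.Finite K (CechH1 A.X.hom U) ∧ Module.finrank K (CechH1 A.X.hom U) = A.dim := by
  let g : (A.baseChange L).X.left ⟶ A.X.left := pullback.fst A.X.hom (Spec.map (CommRingCat.ofHom (algebraMap K L)))
  haveI : IsAffineHom g := MorphismProperty.pullback_fst (P := @IsAffineHom) _ _ inferInstance
  refine finrank_cechH1_structureSheaf_eq_dim_of_baseChange L A U hU (h (preimageFamily g U) (fun i => (hU i).preimage g) ?_)
  exact g.iSup_preimage_eq_top hUcov

/-- **[MumfordAV1970] §13 Cor. 2 OVER ANY FIELD FROM THE ALGEBRAICALLY CLOSED CASE**: if `dim_{K̄} Ȟ¹(𝔘′, 𝒪_{A_{K̄}}) = dim A_{K̄}` (finite) for every finite affine cover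
of `A_{K̄}` (`K̄ := AlgebraicClosure K`), then `dim_K Ȟ¹(𝔘, 𝒪_A) = dim A` (finite) for every finite affine cover of `A`.
[cite: MumfordAV1970, §13 Cor. 2 (p. 129)] [cite: StacksProject, Tag 02KH] -/
theorem finrank_cechH1_structureSheaf_eq_dim_of_algClosure
    (h : ∀ {κ' : Type} [Finite κ'] (U' : κ' → (A.baseChange (AlgebraicClosure K)).X.left.Opens), (∀ i, IsAffineOpen (U' i)) → iSup U' = ⊤ →
      Module.Finite (AlgebraicClosure K) (CechH1 (A.baseChange (AlgebraicClosure K)).X.hom U') ∧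
        Module.finrank (AlgebraicClosure K) (CechH1 (A.baseChange (AlgebraicClosure K)).X.hom U') = (A.baseChange (AlgebraicClosure K)).dim)
    {κ : Type} [Finite κ] (U : κ → A.X.left.Opens) (hU : ∀ i, IsAffineOpen (U i)) (hUcov : iSup U = ⊤) :
    Module.Finite K (CechH1 A.X.hom U) ∧ Module.finrank K (CechH1 A.X.hom U) = A.dim :=
  finrank_cechH1_structureSheaf_eq_dim_of_forall_cover_baseChange (AlgebraicClosure K) A h U hU hUcov

end Reduce

end Literature.AlgebraicGeometry.AbelianVarieties

end
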